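import Summits.BirchSwinnertonDyer.BirchSwinnertonDyer.Theses.SemiOrdinaryEisensteinDescent
import Summits.BirchSwinnertonDyer.BirchSwinnertonDyer.Theorems.ClassRecordThreeEulerHalvesAtThreeJetchevTight
import Summits.BirchSwinnertonDyer.BirchSwinnertonDyer.Theorems.SemiOrdinaryEisensteinDescentWildSigmaDivisibilityAtThreeMultiCarrierTight
import HarnessLib

/-!
# Negative-lane lemmas for crux J‴ `SemiOrdinaryEisensteinDescent.WildSigmaDivisibilityAtThreeMultiCarrier`
# (stmt-BirchSwinnertonDyer-25898), part (C): J‴ in McCallum's currency `t ≤ M_∞`, and the SHAPE OF A REFUTATION —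
# a Kolyvagin certificate of level `< t` on one cut frame — which, by the accepted tightness theorem, refutes BSD₃ on the cell

Refuter vet file (tk5j gen 4, 2026-08-28; `--supports` stmt-BirchSwinnertonDyer-25898, helper). Nothing here refutes the crux, which
stays OPEN research, and nothing here asserts any route statement positively; BSD is not proved by anything here. Sorry-free,
standard axioms; DEFINITIONS ONLY except in §C3, whose print inputs are displayed hypotheses BY NAME.

* §C1 `le_minf_of_wildSigmaDivisibilityAtThreeMultiCarrier`: **J‴ ⟹ McCallum's `t ≤ M_∞`** at every cut multi-carrier frame,
  `t = ord₃ ∏_q c_q + ord₃ c(Dt)`, `M_∞ = Koly.Minf Dt H.β ι 3` AS DEFINED ON THE TREE (`KolyvaginLine` §1) — by the definitions-only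
  bridge `Koly.globalDivisibility_iff_le_minf`, whose left side is J‴'s tail token for token. (The converse direction is the same
  bridge read backwards; it concludes J‴ and is therefore not stated on this lane.)
* §C2 `not_certificateAt_of_wildSigmaDivisibilityAtThreeMultiCarrier` and
  `wildSigmaDivisibilityAtThreeMultiCarrier_false_of_certificateAt`: **what a counterexample to J‴ must be** — ONE frame of the cell
  (onto wild `r = 1` curve at `3`, admissible `K` with `d_K` odd `≠ −3`, `L(E^{d_K},1) ≠ 0`, datum `Dt`, Heegner datum `H`, non-torsion
  `P ↦ y_K`) passing the multi-carrier cut and carrying a Kolyvagin certificate `Koly.CertificateAt Dt H.β ι 3 M` of some level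
  `M < t` (a square-free `n ∈ S_r(M+1)` of Zhang–Kolyvagin primes with a datum `d` of conductor `n` and `P(n) ∉ 3^{M+1}E(K[n])`).
* §C3 `not_leaf_and_rankZero_of_certificateAt`: composed with the accepted tightness theorem
  `WildSigmaDivisibilityAtThreeMultiCarrierTight.wildSigmaDivisibilityAtThreeMultiCarrier_of_wAllExclAddWildRankOneSurj_of_wAllExclAddWildRankZero`
  (J‴ BY NAME from the leaf `WAllExclAddWildRankOneSurj`, the residual `WAllExclAddWildRankZero` and six named print facts), such a
  certificate contradicts `WAllExclAddWildRankOneSurj ∧ WAllExclAddWildRankZero` given {Gross–Zagier, Kolyvagin, GZK, modularity,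
  GZ86 I.(7.3), Matar–Nekovář 2019 Thm. 0.7-lower}: **«no kill of J‴ short of a counterexample to BSD₃ on the cell» as a kernel
  statement.** [cite: McCallumLMS1991, §5 (p. 303) definitions of ord_p(P_n), M_r and Cor. 5.6 (p. 310)]
  [cite: MatarNekovar2019, Thm. 0.7 (p. 456) and §0.11 (p. 457)] [folklore]
-/

-- single-conjunct summit: `Summit.BirchSwinnertonDyer.BirchSwinnertonDyer.…` repeats the name by design (tree layout D-0017)
set_option linter.dupNamespace false
set_option autoImplicit false

open scoped Classical

namespace Summit.BirchSwinnertonDyer.BirchSwinnertonDyer.Theorems.WildSigmaDivisibilityAtThreeMultiCarrier.Negative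

open WeierstrassCurve NumberField
  Literature.NumberTheory.EllipticCurves
  Literature.NumberTheory.EllipticCurves.ModularForms
  Summit.BirchSwinnertonDyer.Rank1Residual
  Summit.BirchSwinnertonDyer.Rank1Residual.Additive
  Summit.BirchSwinnertonDyer.Rank1Residual.X11b
  Summit.BirchSwinnertonDyer.Rank1Residual.X11b.Three
  Summit.BirchSwinnertonDyer.BirchSwinnertonDyer.Theses.SemiOrdinaryEisensteinDescent

/-! ## §C1 J‴ in McCallum's currency -/

/-- **J‴ ⟹ `t ≤ M_∞` on every cut multi-carrier frame** (definitions only; `t = ord₃ ∏ c_q + ord₃ c(Dt)`,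
`M_∞ = Koly.Minf Dt H.β ι 3`). [cite: McCallumLMS1991, §5 (p. 303) and Cor. 5.6 (p. 310)] -/
theorem le_minf_of_wildSigmaDivisibilityAtThreeMultiCarrier (hJ : WildSigmaDivisibilityAtThreeMultiCarrier)
    (W : WeierstrassCurve ℚ) [W.IsElliptic] [W.IsGloballyMinimal] (N : ℕ) [NeZero N] (K : Type) [Field K]
    [NumberField K] (Dt : ModularParametrizationData W N) (H : HeegnerDatum N (NumberField.discr K))
    (ι : K →+* ℂ) (P : (W.baseChange K).toAffine.Point)
    (hO6 : ClassO6 W 3) (hsurj : W.HasSurjectiveModNGaloisRep 3) (hr : W.analyticRank = 1) (hN : W.conductorNorm ℤ = N)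
    (hK : IsImaginaryQuadratic K) (hHH : SatisfiesHeegnerHypothesis N K)
    (hLd : (W.quadraticTwist (NumberField.discr K : ℚ)).entireLFunction 1 ≠ 0)
    (hP : (WeierstrassCurve.Affine.Point.map ι.toRatAlgHom) P = heegnerPointComplex Dt H) (hnt : ¬ IsOfFinAddOrder P)
    (hodd : Odd (NumberField.discr K)) (h3 : NumberField.discr K ≠ -3)
    (hcut : ∀ (q : ℕ) [Fact q.Prime], q ∣ N → padicValNat 3 ((W.baseChange ℚ_[q]).localTamagawaNumber ℤ_[q]) <
        padicValNat 3 W.tamagawaProduct + padicValNat 3 Dt.c.natAbs) :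
    ((padicValNat 3 W.tamagawaProduct + padicValNat 3 Dt.c.natAbs : ℕ) : ℕ∞) ≤ Koly.Minf Dt H.β ι 3 :=
  (Koly.globalDivisibility_iff_le_minf Dt H.β ι 3 _).mp (hJ W N K Dt H ι P hO6 hsurj hr hN hK hHH hLd hP hnt hodd h3 hcut)

/-! ## §C2 The shape of a refutation: a certificate below the depth on one cut frame -/

/-- **J‴ ⟹ no Kolyvagin certificate of level `< t` on any cut multi-carrier frame** (definitions only).
[cite: McCallumLMS1991, §5 (p. 303), definition of M_r (the certificate shape)] -/
theorem not_certificateAt_of_wildSigmaDivisibilityAtThreeMultiCarrier (hJ : WildSigmaDivisibilityAtThreeMultiCarrier)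
    (W : WeierstrassCurve ℚ) [W.IsElliptic] [W.IsGloballyMinimal] (N : ℕ) [NeZero N] (K : Type) [Field K]
    [NumberField K] (Dt : ModularParametrizationData W N) (H : HeegnerDatum N (NumberField.discr K))
    (ι : K →+* ℂ) (P : (W.baseChange K).toAffine.Point)
    (hO6 : ClassO6 W 3) (hsurj : W.HasSurjectiveModNGaloisRep 3) (hr : W.analyticRank = 1) (hN : W.conductorNorm ℤ = N)
    (hK : IsImaginaryQuadratic K) (hHH : SatisfiesHeegnerHypothesis N K)
    (hLd : (W.quadraticTwist (NumberField.discr K : ℚ)).entireLFunction 1 ≠ 0)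
    (hP : (WeierstrassCurve.Affine.Point.map ι.toRatAlgHom) P = heegnerPointComplex Dt H) (hnt : ¬ IsOfFinAddOrder P)
    (hodd : Odd (NumberField.discr K)) (h3 : NumberField.discr K ≠ -3)
    (hcut : ∀ (q : ℕ) [Fact q.Prime], q ∣ N → padicValNat 3 ((W.baseChange ℚ_[q]).localTamagawaNumber ℤ_[q]) <
        padicValNat 3 W.tamagawaProduct + padicValNat 3 Dt.c.natAbs)
    {M : ℕ} (hM : M < padicValNat 3 W.tamagawaProduct + padicValNat 3 Dt.c.natAbs) :
    ¬ Koly.CertificateAt Dt H.β ι 3 M :=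
  (Koly.globalDivisibility_iff_forall_not_certificateAt Dt H.β ι 3 _).mp
    (hJ W N K Dt H ι P hO6 hsurj hr hN hK hHH hLd hP hnt hodd h3 hcut) M hM

/-- **A certificate below the depth on one cut frame refutes J‴.** This is the exact shape an unconditional refutation
`¬ WildSigmaDivisibilityAtThreeMultiCarrier` must exhibit. [cite: McCallumLMS1991, §5 (p. 303) and Cor. 5.6 (p. 310)] -/
theorem wildSigmaDivisibilityAtThreeMultiCarrier_false_of_certificateAt
    (hex : ∃ (W : WeierstrassCurve ℚ) (_ : W.IsElliptic) (_ : W.IsGloballyMinimal) (N : ℕ) (_ : NeZero N)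
      (K : Type) (_ : Field K) (_ : NumberField K) (Dt : ModularParametrizationData W N)
      (H : HeegnerDatum N (NumberField.discr K)) (ι : K →+* ℂ) (P : (W.baseChange K).toAffine.Point),
      ClassO6 W 3 ∧ W.HasSurjectiveModNGaloisRep 3 ∧ W.analyticRank = 1 ∧ W.conductorNorm ℤ = N ∧
      IsImaginaryQuadratic K ∧ SatisfiesHeegnerHypothesis N K ∧
      (W.quadraticTwist (NumberField.discr K : ℚ)).entireLFunction 1 ≠ 0 ∧
      (WeierstrassCurve.Affine.Point.map ι.toRatAlgHom) P = heegnerPointComplex Dt H ∧ ¬ IsOfFinAddOrder P ∧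
      Odd (NumberField.discr K) ∧ NumberField.discr K ≠ -3 ∧
      (∀ (q : ℕ) [Fact q.Prime], q ∣ N → padicValNat 3 ((W.baseChange ℚ_[q]).localTamagawaNumber ℤ_[q]) <
        padicValNat 3 W.tamagawaProduct + padicValNat 3 Dt.c.natAbs) ∧
      ∃ M : ℕ, M < padicValNat 3 W.tamagawaProduct + padicValNat 3 Dt.c.natAbs ∧ Koly.CertificateAt Dt H.β ι 3 M) :
    ¬ WildSigmaDivisibilityAtThreeMultiCarrier := by
  rintro hJ
  obtain ⟨W, _, _, N, _, K, _, _, Dt, H, ι, P, hO6, hsurj, hr, hN, hK, hHH, hLd, hP, hnt, hodd, h3, hcut, M, hM, hcert⟩ := hex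
  exact not_certificateAt_of_wildSigmaDivisibilityAtThreeMultiCarrier hJ W N K Dt H ι P hO6 hsurj hr hN hK hHH hLd hP hnt
    hodd h3 hcut hM hcert

/-! ## §C3 Such a certificate refutes BSD₃ on the cell (modulo six named print facts) -/

/-- **No kill of J‴ short of a counterexample to BSD₃ on the cell.** A cut multi-carrier frame with a Kolyvagin certificate of
level `< t` contradicts `WAllExclAddWildRankOneSurj ∧ WAllExclAddWildRankZero`, given Gross–Zagier, Kolyvagin, GZK, modularity,
GZ86 I.(7.3) and the lower half of Kolyvagin's structure theorem under irreducibility (Matar–Nekovář 2019 Thm. 0.7/§0.11) — all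
displayed as hypotheses BY NAME; CONDITIONAL, nothing asserted about any curve.
[cite: MatarNekovar2019, Thm. 0.7 (p. 456) and §0.11 (p. 457)] [cite: GrossZagier1986, Thm. I.(6.3), (7.3) and V (2.2)] -/
theorem not_leaf_and_rankZero_of_certificateAt
    (hGZ : ∀ (N : ℕ) [NeZero N] (W : WeierstrassCurve ℚ) (K : Type) [Field K] [NumberField K], gross_zagier N W K)
    (hKo : ∀ (N : ℕ) [NeZero N] (W : WeierstrassCurve ℚ) (K : Type) [Field K] [NumberField K], kolyvagin N W K)
    (hGZK : rank_eq_analyticRank_of_analyticRank_le_one) (hmod : hasEntireLFunction_rat)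
    (hGZ73 : GrossZagier1986_thm_I_7_3)
    (hMNlow : MatarNekovar2019.thm07_pow_dvd_card_sha_primary_of_certificate_of_irreducible)
    (hex : ∃ (W : WeierstrassCurve ℚ) (_ : W.IsElliptic) (_ : W.IsGloballyMinimal) (N : ℕ) (_ : NeZero N)
      (K : Type) (_ : Field K) (_ : NumberField K) (Dt : ModularParametrizationData W N)
      (H : HeegnerDatum N (NumberField.discr K)) (ι : K →+* ℂ) (P : (W.baseChange K).toAffine.Point),
      ClassO6 W 3 ∧ W.HasSurjectiveModNGaloisRep 3 ∧ W.analyticRank = 1 ∧ W.conductorNorm ℤ = N ∧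
      IsImaginaryQuadratic K ∧ SatisfiesHeegnerHypothesis N K ∧
      (W.quadraticTwist (NumberField.discr K : ℚ)).entireLFunction 1 ≠ 0 ∧
      (WeierstrassCurve.Affine.Point.map ι.toRatAlgHom) P = heegnerPointComplex Dt H ∧ ¬ IsOfFinAddOrder P ∧
      Odd (NumberField.discr K) ∧ NumberField.discr K ≠ -3 ∧
      (∀ (q : ℕ) [Fact q.Prime], q ∣ N → padicValNat 3 ((W.baseChange ℚ_[q]).localTamagawaNumber ℤ_[q]) <
        padicValNat 3 W.tamagawaProduct + padicValNat 3 Dt.c.natAbs) ∧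
      ∃ M : ℕ, M < padicValNat 3 W.tamagawaProduct + padicValNat 3 Dt.c.natAbs ∧ Koly.CertificateAt Dt H.β ι 3 M) :
    ¬ (Summit.BirchSwinnertonDyer.WAllExclAddWildRankOneSurj ∧ Summit.BirchSwinnertonDyer.WAllExclAddWildRankZero) := by
  rintro ⟨hLeaf, hZ⟩
  exact wildSigmaDivisibilityAtThreeMultiCarrier_false_of_certificateAt hex
    (WildSigmaDivisibilityAtThreeMultiCarrierTight.wildSigmaDivisibilityAtThreeMultiCarrier_of_wAllExclAddWildRankOneSurj_of_wAllExclAddWildRankZero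
      hGZ hKo hGZK hmod hGZ73 hMNlow hLeaf hZ)

end Summit.BirchSwinnertonDyer.BirchSwinnertonDyer.Theorems.WildSigmaDivisibilityAtThreeMultiCarrier.Negative
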